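import Summits.HodgeConjecture.HodgeConjecture.Theorems.Ring2WeilCoverageCyclotomicUnitSignaturesFamily
import Summits.HodgeConjecture.HodgeConjecture.Theorems.Ring2WeilCoverageCyclotomicUnitGeomSums
import Summits.HodgeConjecture.HodgeConjecture.Theorems.Ring2WeilCoverageFullSignatureExceptionalLevels
import HarnessLib

/-!
# Weil-type family coverage — THE `g = 4` CYCLOTOMIC LEVEL `16`: THEOREM L (ii) IS KERNEL (geometric-sum units),
# hence the FULL unit signature of `ℚ(ζ₁₆)⁺ = ℚ(√(2+√2))`, the census rows `(16, ℚ(i))`, `(16, ℚ(√−2))` — YES —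
# and EVERY polarisation type on EVERY `ℤ[ζ₁₆]`-CM fourfold (the exceptional-level law of part 74 at `16`)

research route conditional on HC_CM; not a corollary; Q11.4-sentence-2 already refuted in dim ≥ 3.

Ring 2, WEIL-TYPE FAMILY-COVERAGE CENSUS (`HOME/WEIL-FAMILY-COVERAGE.md` `## b01`, block b01.46 «the cyclotomic CM
FOURFOLDS of Weil type»; owner ring2-b01), part 76 of the `Ring2WeilCoverage*` series; the `2`-power companion of
part 75 (levels `15, 20, 24`).  At `M = 16 = 2⁴` no `1 − ζ^a` is a unit, so (as at `32`, part 22) the family is part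
20's geometric-sum units `v(a, c) = ζ^c(1 + ζ + ⋯ + ζ^{a−1})` (`a` odd, `2c + a − 1 ≡ 0 (mod 32)`; sign law
`negAtG (a,c) t := 16 < at mod 32`, value `sin(πat/16)/sin(πt/16)`):

* `familyProperty_sixteen` (part 21's family property from part 20), `witnessTable_sixteen` (`decide +kernel`;
  generators `(a,c)` = (3,15), (5,14), (7,13)), `witnessProperty_sixteen`: the witness property `(W)`;
* **`exists_units_sign_eq_sixteen` — THEOREM L (ii) at `16`**: every EVEN sign pattern on a CM type of `ℚ(ζ₁₆)` is a
  real unit's;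
* since `16 = 2⁴` is EXCEPTIONAL (part 73: Hasse's unit `ζ⁻²(1 + ζ + ζ² + ζ³ + ζ⁴)` of norm `−1`), part 74 upgrades
  this to **`forall_sign_sixteen`: EVERY sign pattern on every CM type is a real unit's** — the units of
  `ℚ(ζ₁₆)⁺ = ℚ(√(2+√2))` have all `2⁴` signatures (Weber) — and to **`exists_pos_isOfType_sixteen`: on EVERY
  `ℤ[ζ₁₆]`-CM torus `ℂ^Φ/D(𝔪)`, for EVERY `Φ`, EVERY type with a skew representative occurs as the type of a
  `Φ`-positive divisor**; in particular `exists_principal_sixteen` (an `ι`-compatible PRINCIPAL polarisation on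
  `ℂ^Φ/Φ(ℤ[ζ₁₆])` for every `Φ`, balanced or not) and `exists_type_span_sixteen` (every principal type `(ϖ₀)`);
* the two census rows in the format of parts 15–22/75: **`exists_principal_sixteen_sqrt_neg_one`** (`Φ` balanced for
  `N_K = {3, 7, 11, 15}`, `K = ℚ(i)`, `n₋ = 2`) and **`exists_principal_sixteen_sqrt_neg_two`** (`N_K = {5, 7, 13, 15}`,
  `K = ℚ(√−2)`, `n₋ = 2`) — YES (here also instances of `exists_principal_sixteen`).

With parts 75/76 the census's kernel verdicts cover EVERY cyclotomic level `M` with `φ(M) ≤ 24` that contains an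
imaginary quadratic field with a balanced CM type (`φ(M) ∈ {8, 12, 16, 20, 24}`).  As at `15/20/24`, the `K`-balanced
types at `16` are the imprimitive ones (COR-CM `CorCM.CyclotomicRank.isNondegenerate_iff_isSimple_sixteen` with
`Pohlmann1968.not_isNondegenerate_of_fibres_balanced`; part 77): these CM points are NON-simple fourfolds.

HONEST FRAMING: statements about Shimura's divisors of type `(K; Φ; 𝔣₀)` on CM tori with multiplication by `ℤ[ζ₁₆]`
and about units of `𝓞 K`; the witness table is checked by `decide +kernel`; the sets `N_K` are displayed finite sets
of residues (`χ₋₄(t) = −1 ⟺ t ≡ 3 (4)`, `χ₋₈(t) = −1 ⟺ t ≡ 5, 7 (8)` — docstring-level); nothing here is a statement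
about Hodge classes, `W_K`, general members or HC; `HC_CM` is used nowhere.  No `def`, no named fact, no `sorry`.

References: [cite: Shimura1998, §14.3 Prop. 4–5, pp. 103–104]; [cite: Washington1997, §8.1, Lemma 8.1];
[cite: DummitDummitKisilevsky2019, §3 (Prop. 1–2, Hasse's unit)]; census b01.23 (A)/(D), b01.45 (seat-derived).
-/

noncomputable section

open Polynomial NumberField Complex Finset
open scoped Real nonZeroDivisors

namespace Summit.HodgeConjecture.Ring2WeilCoverage.CyclotomicSignaturesLevel16

open Literature.AlgebraicGeometry.Motives (CMType)
open Literature.AlgebraicGeometry.HodgeTheory (IsCMTypeSet)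
open Literature.NumberTheory.ComplexMultiplication
open Literature.NumberTheory.ComplexMultiplication.CMTypeLattice (IsOfType)
open Literature.AlgebraicGeometry.ComplexMultiplication.CyclotomicCMType (exists_apply_eq_toCircle)
open Summit.HodgeConjecture.Ring2WeilCoverage.CyclotomicUnitSignaturesFamily
open Summit.HodgeConjecture.Ring2WeilCoverage.CyclotomicUnitGeomSums
open Summit.HodgeConjecture.Ring2WeilCoverage.FullSignatureExceptionalLevels

variable {K : Type} [Field K] [NumberField K] {ζ : K}

/-- `𝐞(t) = exp(2πi t/16) ∈ ℂ` (`ZMod.toCircle`). -/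
local notation3 (prettyPrint := false) "𝐞 " t:max => ((ZMod.toCircle t : Circle) : ℂ)

/-- the sign law of the geometric-sum unit `v(a,c)` at the unit residue `t` (part 20): `16 < at mod 32`. -/
local notation3 (prettyPrint := false) "negAtG" =>
  (fun (x : ℕ × ℕ) (t : ZMod 16) => 16 < x.1 * ZMod.val t % (2 * 16))

/-- admissibility of a pair `(a, c)` (part 20): `a` prime to `16`, `(2c + a − 1) mod 32 = 0`, `a ≥ 1`. -/
local notation3 (prettyPrint := false) "admG" =>
  (fun x : ℕ × ℕ => Nat.Coprime x.1 16 ∧ (2 * x.2 + x.1 - 1) % (2 * 16) = 0 ∧ 1 ≤ x.1)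

/-- the sign pattern of the signed product `(A, ε)` at `t`. -/
local notation3 (prettyPrint := false) "pat " A:max ε:max t:max =>
  Odd ((Finset.filter (fun x : ℕ × ℕ => negAtG x t) A).card + (if (ε : Bool) then 1 else 0))

/-! ### §1 The witness property and THEOREM L (ii) at `16` -/

/-- **The family property of part 21 for the geometric-sum units at level 16**: admissible signed products are units
of `𝓞 K` fixed by `ρ` with the sign law `negAtG` (part 20).
research route conditional on HC_CM; not a corollary; Q11.4-sentence-2 already refuted in dim ≥ 3. [cite: Washington1997, §8.1, Lemma 8.1] -/
theorem familyProperty_sixteen [IsCMField K] (hζ : IsPrimitiveRoot ζ 16) :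
    ∀ A : Finset (ℕ × ℕ), (∀ x ∈ A, admG x) → ∀ ε : Bool,
      ∃ u : (𝓞 K)ˣ, IsCMField.complexConj K ((u : 𝓞 K) : K) = ((u : 𝓞 K) : K) ∧
        ∀ (φ : K →+* ℂ) (t : ZMod 16), φ ζ = 𝐞 t → t.val.Coprime 16 →
          (((φ ((u : 𝓞 K) : K)).re < 0) ↔ pat A ε t) := by
  intro A hA ε
  obtain ⟨u, hu, hconj⟩ := exists_units_coe_eq_geomSum (by norm_num) hζ hA ε
  refine ⟨u, hconj, fun φ t hφt ht => ?_⟩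
  rw [hu]
  exact (re_embedding_prod_geomSum_neg_iff (by norm_num) hφt ht A hA ε).1

/-- **Witness table at level 16** (`decide +kernel`): for every unit residue `s ∉ {1, −1}` mod `16` the listed signed
product of admissible geometric-sum units is negative exactly at the places `{±1, ±s}`.
research route conditional on HC_CM; not a corollary; Q11.4-sentence-2 already refuted in dim ≥ 3. [folklore] -/
theorem witnessTable_sixteen :
    ∀ s ∈ (Finset.univ.filter fun s : ZMod 16 => s.val.Coprime 16 ∧ s ≠ 1 ∧ s ≠ -1),
      ∃ w ∈ ({
    (3, {(3, 15), (5, 14)}, true),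
    (5, {(7, 13)}, true),
    (7, {(3, 15), (5, 14), (7, 13)}, true),
    (9, {(3, 15), (5, 14), (7, 13)}, true),
    (11, {(7, 13)}, true),
    (13, {(3, 15), (5, 14)}, true)} :
      Finset (ZMod 16 × Finset (ℕ × ℕ) × Bool)),
        w.1 = s ∧ (∀ x ∈ w.2.1, admG x) ∧
          ∀ t ∈ (Finset.univ.filter fun t : ZMod 16 => t.val.Coprime 16),
            (pat w.2.1 w.2.2 t ↔ (t = 1 ∨ t = -1 ∨ t = s ∨ t = -s)) := by
  decide +kernel

/-- **The witness property `(W)` of part 21 holds at level 16** for the geometric-sum family.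
research route conditional on HC_CM; not a corollary; Q11.4-sentence-2 already refuted in dim ≥ 3. [folklore] -/
theorem witnessProperty_sixteen :
    ∀ s : ZMod 16, s.val.Coprime 16 → s ≠ 1 → s ≠ -1 →
      ∃ A : Finset (ℕ × ℕ), ∃ ε : Bool, (∀ x ∈ A, admG x) ∧
        ∀ t : ZMod 16, t.val.Coprime 16 → (pat A ε t ↔ (t = 1 ∨ t = -1 ∨ t = s ∨ t = -s)) := by
  intro s hs h1 h2
  obtain ⟨w, -, rfl, hA, hP⟩ :=
    witnessTable_sixteen s (Finset.mem_filter.mpr ⟨Finset.mem_univ _, hs, h1, h2⟩)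
  exact ⟨w.2.1, w.2.2, hA, fun t ht => hP t (Finset.mem_filter.mpr ⟨Finset.mem_univ _, ht⟩)⟩

open scoped Classical in
/-- **THEOREM L (ii) AT LEVEL 16 — every even sign pattern on a CM type of `ℚ(ζ₁₆)` is a real unit's** (explicit
geometric-sum cyclotomic units; no class number, no CFT): for any `K` with `IsCyclotomicExtension {16} ℚ K`,
`[IsCMField K]`, every CM type `Φ` and every `S ⊆ Φ` of even size there is a unit of `𝓞 K` fixed by `ρ`, negative
exactly on `S`.
research route conditional on HC_CM; not a corollary; Q11.4-sentence-2 already refuted in dim ≥ 3. [cite: Washington1997, §8.1, Lemma 8.1] -/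
theorem exists_units_sign_eq_sixteen [IsCMField K] [IsCyclotomicExtension {16} ℚ K] (hζ : IsPrimitiveRoot ζ 16)
    (Φ : CMType K) (S : Set (K →+* ℂ)) (hS : S ⊆ Φ.1) (hev : Even S.ncard) :
    ∃ u : (𝓞 K)ˣ, IsCMField.complexConj K ((u : 𝓞 K) : K) = ((u : 𝓞 K) : K) ∧
      ∀ φ ∈ Φ.1, ((φ ((u : 𝓞 K) : K)).re < 0 ↔ φ ∈ S) :=
  exists_units_sign_eq_family _ _ hζ (familyProperty_sixteen hζ) witnessProperty_sixteen Φ S hS hev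

/-! ### §2 `16` is exceptional: full signature, every type on every `ℤ[ζ₁₆]`-CM torus -/

/-- `16 = 2⁴` is an exceptional level in the sense of parts 72–74. [folklore] -/
theorem exceptional_sixteen :
    (∃ a : ℕ, (16 : ℕ) = 2 ^ a) ∨ ∃ p a : ℕ, p.Prime ∧ p ≠ 2 ∧ ((16 : ℕ) = p ^ a ∨ (16 : ℕ) = 2 * p ^ a) :=
  Or.inl ⟨4, by norm_num⟩

open scoped Classical in
/-- **FULL UNIT SIGNATURE OF `ℚ(ζ₁₆)⁺ = ℚ(√(2+√2))`** (Weber's theorem at `2⁴`, kernel): for any `K` with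
`IsCyclotomicExtension {16} ℚ K`, `[IsCMField K]`, every CM type `Φ` and EVERY `S ⊆ Φ` (any parity) there is a unit
of `𝓞 K` fixed by `ρ` negative exactly on `S` — §1's even patterns and the norm-`−1` unit of part 73, through part
74's `forall_sign_of_exceptional`.
research route conditional on HC_CM; not a corollary; Q11.4-sentence-2 already refuted in dim ≥ 3. [cite: DummitDummitKisilevsky2019, §3 Prop. 2 (Weber)] -/
theorem forall_sign_sixteen [IsCMField K] [IsCyclotomicExtension {16} ℚ K] (hζ : IsPrimitiveRoot ζ 16)
    (Φ : CMType K) (S : Set (K →+* ℂ)) (hS : S ⊆ Φ.1) :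
    ∃ u : (𝓞 K)ˣ, IsCMField.complexConj K ((u : 𝓞 K) : K) = ((u : 𝓞 K) : K) ∧
      ∀ φ ∈ Φ.1, ((φ ((u : 𝓞 K) : K)).re < 0 ↔ φ ∈ S) :=
  forall_sign_of_exceptional hζ (by norm_num) exceptional_sixteen Φ (exists_units_sign_eq_sixteen hζ Φ) S hS

section Tori

variable (Φ : CMType K) (𝔪 : (FractionalIdeal (𝓞 K)⁰ K)ˣ) {ζ₀ : K} {𝔣₀ : Ideal (𝓞 (maximalRealSubfield K))}

/-- **EVERY TYPE ON EVERY `ℤ[ζ₁₆]`-CM FOURFOLD.**  For any `K` with `IsCyclotomicExtension {16} ℚ K`, `[IsCMField K]`,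
EVERY CM type `Φ`, every lattice `𝔪` and every skew `ζ₀ ≠ 0` of type `𝔣₀` on `D(𝔪)` (`IsOfType 𝔪 ζ₀ 𝔣₀`), the
torus `ℂ^Φ/D(𝔪)` carries a `Φ`-POSITIVE divisor of type `(K; Φ; 𝔣₀)` — whatever the parity of
`#{φ ∈ Φ : Im ζ₀^φ < 0}` (part 74 at `n = 16`, `hU'` discharged by §1).
research route conditional on HC_CM; not a corollary; Q11.4-sentence-2 already refuted in dim ≥ 3. [cite: Shimura1998, §14.3 Prop. 5, p. 104] -/
theorem exists_pos_isOfType_sixteen [IsCMField K] [IsCyclotomicExtension {16} ℚ K] (hζ : IsPrimitiveRoot ζ 16)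
    (hζ₀ : IsCMField.complexConj K ζ₀ = -ζ₀) (h0 : ζ₀ ≠ 0) (hT : IsOfType 𝔪 ζ₀ 𝔣₀) :
    ∃ ζ' : K, IsCMField.complexConj K ζ' = -ζ' ∧ (∀ φ : Φ.1, 0 < (φ.1 ζ').im) ∧ IsOfType 𝔪 ζ' 𝔣₀ :=
  exists_pos_isOfType_of_exceptional Φ 𝔪 hζ (by norm_num) exceptional_sixteen hζ₀ h0 hT
    (exists_units_sign_eq_sixteen hζ Φ)

end Tori

/-- **AN `ι`-COMPATIBLE PRINCIPAL POLARISATION ON `ℂ^Φ/Φ(ℤ[ζ₁₆])` FOR EVERY CM TYPE `Φ`** — balanced or not for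
`ℚ(i)` / `ℚ(√−2)` (part 74 `exists_principal_of_exceptional`; reference skew `ξ = ζ³/Φ₁₆′(ζ)` of type `⊤`).
research route conditional on HC_CM; not a corollary; Q11.4-sentence-2 already refuted in dim ≥ 3. [cite: Shimura1998, §14.3 Prop. 5, p. 104] -/
theorem exists_principal_sixteen [IsCMField K] [IsCyclotomicExtension {16} ℚ K] (hζ : IsPrimitiveRoot ζ 16)
    (Φ : CMType K) :
    ∃ ζ' : K, IsCMField.complexConj K ζ' = -ζ' ∧ (∀ φ : Φ.1, 0 < (φ.1 ζ').im) ∧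
        IsOfType (1 : (FractionalIdeal (𝓞 K)⁰ K)ˣ) ζ' ⊤ :=
  exists_principal_of_exceptional hζ (by norm_num) exceptional_sixteen Φ (exists_units_sign_eq_sixteen hζ Φ)

/-- **EVERY PRINCIPAL TYPE `(ϖ₀)` ON `ℂ^Φ/Φ(ℤ[ζ₁₆])`**: for every CM type `Φ` and every real `ϖ₀ ∈ 𝓞 K⁺ ∖ 0` a skew
`Φ`-positive `ζ′` with `IsOfType 1 ζ′ (ϖ₀)` exists — whatever the sign of `N(ϖ₀)` (part 74
`exists_type_span_of_exceptional`; contrast the two-sided norm-sign law of parts 55/56 at `15, 20, 24`).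
research route conditional on HC_CM; not a corollary; Q11.4-sentence-2 already refuted in dim ≥ 3. [cite: Shimura1998, §14.3 Prop. 4–5, pp. 103–104] -/
theorem exists_type_span_sixteen [IsCMField K] [IsCyclotomicExtension {16} ℚ K] (hζ : IsPrimitiveRoot ζ 16)
    (Φ : CMType K) {ϖ₀ : 𝓞 (maximalRealSubfield K)} (hϖ0 : ϖ₀ ≠ 0) :
    ∃ ζ' : K, IsCMField.complexConj K ζ' = -ζ' ∧ (∀ φ : Φ.1, 0 < (φ.1 ζ').im) ∧
        IsOfType (1 : (FractionalIdeal (𝓞 K)⁰ K)ˣ) ζ' (Ideal.span {ϖ₀}) :=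
  exists_type_span_of_exceptional hζ (by norm_num) exceptional_sixteen Φ hϖ0 (exists_units_sign_eq_sixteen hζ Φ)

/-! ### §3 The two census rows at `16` in the format of parts 15–22/75 -/

open scoped Classical in
/-- **CENSUS ROW `(ℚ(ζ₁₆), ℚ(i))` — UNCONDITIONAL YES: the principal CM torus `ℂ^Φ/Φ(ℤ[ζ₁₆])` CARRIES an
`ι`-compatible principal polarisation** for every CM type `Φ` balanced for `N_K = {3, 7, 11, 15}` (the unit
residues `t ≡ 3 (mod 4)`, `χ_K(t) = −1`, `K = ℚ(i)`; `K`-signature `(2,2)`; `n₋ = 2` is even) — by the family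
route (parts 7/20/21 + the table); also an instance of `exists_principal_sixteen`.
research route conditional on HC_CM; not a corollary; Q11.4-sentence-2 already refuted in dim ≥ 3. [cite: Shimura1998, §14.3 Prop. 5, p. 104] -/
theorem exists_principal_sixteen_sqrt_neg_one [IsCMField K] [IsCyclotomicExtension {16} ℚ K]
    (hζ : IsPrimitiveRoot ζ 16) (Φ : CMType K)
    (hbal : 2 * ((Finset.univ.filter fun t : ZMod 16 => ∃ σ ∈ Φ.1, σ ζ = 𝐞 t) ∩
        ({3, 7, 11, 15} : Finset (ZMod 16))).card =
      (Finset.univ.filter fun t : ZMod 16 => ∃ σ ∈ Φ.1, σ ζ = 𝐞 t).card) :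
    ∃ ζ' : K, IsCMField.complexConj K ζ' = -ζ' ∧ (∀ φ : Φ.1, 0 < (φ.1 ζ').im) ∧
        IsOfType (1 : (FractionalIdeal (𝓞 K)⁰ K)ˣ) ζ' ⊤ := by
  have hg : Nat.totient 16 = 2 * (3 + 1) := by decide
  have hNK : IsCMTypeSet 16 ({3, 7, 11, 15} : Finset (ZMod 16)) := by decide
  have heven : Even (({3, 7, 11, 15} : Finset (ZMod 16)).filter fun t : ZMod 16 => 2 * t.val < 16).card := by
    decide
  exact exists_principal_of_family _ _ hζ hg (familyProperty_sixteen hζ) witnessProperty_sixteen Φ hNK hbal heven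

open scoped Classical in
/-- **CENSUS ROW `(ℚ(ζ₁₆), ℚ(√−2))` — UNCONDITIONAL YES: the principal CM torus `ℂ^Φ/Φ(ℤ[ζ₁₆])` CARRIES an
`ι`-compatible principal polarisation** for every CM type `Φ` balanced for `N_K = {5, 7, 13, 15}` (the unit
residues `t ≡ 5, 7 (mod 8)`, `χ_K(t) = −1`, `K = ℚ(√−2)`; `n₋ = 2` is even).
research route conditional on HC_CM; not a corollary; Q11.4-sentence-2 already refuted in dim ≥ 3. [cite: Shimura1998, §14.3 Prop. 5, p. 104] -/
theorem exists_principal_sixteen_sqrt_neg_two [IsCMField K] [IsCyclotomicExtension {16} ℚ K]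
    (hζ : IsPrimitiveRoot ζ 16) (Φ : CMType K)
    (hbal : 2 * ((Finset.univ.filter fun t : ZMod 16 => ∃ σ ∈ Φ.1, σ ζ = 𝐞 t) ∩
        ({5, 7, 13, 15} : Finset (ZMod 16))).card =
      (Finset.univ.filter fun t : ZMod 16 => ∃ σ ∈ Φ.1, σ ζ = 𝐞 t).card) :
    ∃ ζ' : K, IsCMField.complexConj K ζ' = -ζ' ∧ (∀ φ : Φ.1, 0 < (φ.1 ζ').im) ∧
        IsOfType (1 : (FractionalIdeal (𝓞 K)⁰ K)ˣ) ζ' ⊤ := by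
  have hg : Nat.totient 16 = 2 * (3 + 1) := by decide
  have hNK : IsCMTypeSet 16 ({5, 7, 13, 15} : Finset (ZMod 16)) := by decide
  have heven : Even (({5, 7, 13, 15} : Finset (ZMod 16)).filter fun t : ZMod 16 => 2 * t.val < 16).card := by
    decide
  exact exists_principal_of_family _ _ hζ hg (familyProperty_sixteen hζ) witnessProperty_sixteen Φ hNK hbal heven

end Summit.HodgeConjecture.Ring2WeilCoverage.CyclotomicSignaturesLevel16

end
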